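import Summits.Ventures.PercRepro.RLSRuleTwoLinesT1
import Summits.Ventures.PercRepro.RLSZeroWorldT1B

/-!
# C-025 at q = 3: `R₃⁺` on the plane «two `3`-point lines through a point» at `t = 1`, case (B), and `t = 1` complete
(night-3, gen 4)

`t = 1` with a line `ℓ ⊆ H = cl(E ∖ G)`: the REFINED demand (`not_subset_closure_of_mem_UqG`) leaves at most `8`
bottom sets (`card_UqG_le_of_line_subset_closure`: a demanded `B′` misses a point of `G ∖ ℓ`), and the crude shares on
the good witnesses with the `(L3)` losses of BOTH lines charged (`3(t1z1 − lost4)` per lined `4`-set,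
`8(t1z2 − 2·lost5)` for the plane; the `8` triples and the generic `4`-set lose nothing) pay `8Φ` by the lifted
certificate `W1.t1_two3B` (margins `43.7 / 71.7 / 117.2` at `n = 4, 5, 6`).  **`perFlat_twoLines_t1`** combines the
two cases (a line in `H` — for that line, by symmetry — or neither).
Imports `RLSRuleTwoLinesT1`, `RLSZeroWorldT1B`.  Axioms: standard.
-/

open scoped Matroid

namespace PercRepro

namespace NightThree

open Finset ThmH PerFlat

variable {α : Type*} [DecidableEq α] {M : Matroid α} [M.Finite]

/-! ### `t = 1`, case (B): a line in the hyperplane — the refined demand and the `(L3)` losses -/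

open scoped Classical in
/-- **`t = 1`, the line `ℓ` inside `cl(E ∖ G)`.**  The refined demand leaves at most `8` bottom sets; the crude shares
on the good witnesses, with the `(L3)` losses of BOTH lines charged (`3(t1z1 − lost4)` per lined `4`-set,
`8(t1z2 − 2·lost5)` for the plane), pay `8Φ` by the lifted certificate `W1.t1_two3B`. -/
theorem perFlat_twoLines_t1_of_subset {G ℓ ℓ' : Finset α} {n : ℕ} (hG : G ∈ flatsQ M 3)
    (h : TwoLines M G ℓ ℓ') (hn : 4 ≤ n) (hK : M.eRk ((gr M \ G : Finset α) : Set α) = ((n + 3 : ℕ) : ℕ∞))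
    (hℓ : (ℓ : Set α) ⊆ M.closure ((gr M \ G : Finset α) : Set α)) :
    phiK (n + 4) 3 * ((UqG M (n + 4) 3 G).card : ℚ) ≤ ∑ S ∈ Yq M (n + 4) 3, wPlus M G S := by
  obtain ⟨K, hKsub, hKind, hKcard⟩ := exists_indep_compl_card G (p := n + 3) (le_of_eq hK.symm)
  have hKG : Disjoint K G := by
    rw [Finset.disjoint_left]
    intro x hxK hxG
    have := hKsub hxK
    rw [Finset.mem_sdiff] at this
    exact this.2 hxG
  obtain ⟨hmem3, h𝔅rank, hd34, hd5, hc3, hc4⟩ := twoLines_family hG h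
  obtain ⟨hℓG, hℓ'G, hℓc, hℓ'c, hℓr, hℓ'r, hne, hGc, hsimple, hind⟩ := h
  have h' : TwoLines M G ℓ ℓ' := ⟨hℓG, hℓ'G, hℓc, hℓ'c, hℓr, hℓ'r, hne, hGc, hsimple, hind⟩
  obtain ⟨C, hCK, hCc, hgoodC⟩ := exists_good_triple hG hℓG hℓr hKsub hKind (by omega)
  obtain ⟨C', hC'K, hC'c, hgoodC'⟩ := exists_good_triple hG hℓ'G hℓ'r hKsub hKind (by omega)
  have hnotboth : ∀ B ∈ G.powersetCard 4, ¬ (ℓ ⊆ B ∧ ℓ' ⊆ B) := by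
    rintro B hB ⟨hl, hl'⟩
    have : ℓ ∪ ℓ' ⊆ B := Finset.union_subset hl hl'
    rw [union_eq_of_twoLines hG h'] at this
    have := Finset.card_le_card this
    rw [(Finset.mem_powersetCard.1 hB).2] at this
    omega
  -- the refined demand: at most `8`
  have hdem : ((UqG M (n + 4) 3 G).card : ℚ) ≤ 8 := by
    have := card_UqG_le_of_line_subset_closure (p := n + 4) hℓG hℓc hℓr hGc hℓ
      (by rw [hK]; exact_mod_cast (by omega : n + 3 < n + 4))
    exact_mod_cast this
  -- the crude shares on the good witnesses
  set f : Finset α → Finset α → ℚ := fun B X =>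
    if (ℓ ⊆ B → ¬ C ⊆ X) ∧ (ℓ' ⊆ B → ¬ C' ⊆ X) then
      ((B.card.choose 3 - (if ℓ ⊆ B then 1 else 0) - (if ℓ' ⊆ B then 1 else 0) : ℕ) : ℚ) /
        (((B.card + X.card).choose 3 : ℕ) : ℚ)
    else 0 with hf
  have hsup := supply_ge_of_family hG h𝔅rank hKsub hKind n f (fun B hB X hX => by
    obtain ⟨hXK, _, _⟩ := mem_witnessFamily hX
    have hXind : M.Indep (X : Set α) := hKind.subset (Finset.coe_subset.2 hXK)
    have hXG : Disjoint X G := Finset.disjoint_of_subset_left hXK hKG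
    have hBG := (h𝔅rank B hB).1
    rw [hf]
    dsimp only
    by_cases hgd : (ℓ ⊆ B → ¬ C ⊆ X) ∧ (ℓ' ⊆ B → ¬ C' ⊆ X)
    · rw [if_pos hgd]
      exact wPlus_ge_of_twoLines hG h' hBG hXind hXG hXK
        ⟨fun hl => hgoodC X (hgd.1 hl), fun hl => hgoodC' X (hgd.2 hl)⟩
    · rw [if_neg hgd]
      exact wPlus_nonneg M G (B ∪ X))
  -- the pieces: the triples pay `8·t1z0`
  have h3 : ∑ B ∈ ((G.powersetCard 3).erase ℓ).erase ℓ', ∑ X ∈ witnessFamily K n, f B X = 8 * W1.t1z0Sum n := by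
    have hval : ∀ B ∈ ((G.powersetCard 3).erase ℓ).erase ℓ', ∑ X ∈ witnessFamily K n, f B X = W1.t1z0Sum n := by
      intro B hB
      obtain ⟨_, hBc, hl, hl', _⟩ := hmem3 B hB
      have : ∀ X ∈ witnessFamily K n, f B X = 1 / (((3 + X.card).choose 3 : ℕ) : ℚ) := by
        intro X _
        rw [hf]
        dsimp only
        rw [if_pos ⟨fun h => absurd h hl, fun h => absurd h hl'⟩, hBc]
        simp only [if_neg hl, if_neg hl', Nat.choose_self, Nat.sub_zero, Nat.cast_one]
      rw [Finset.sum_congr rfl this, sum_witness_eq_t1z0 hKcard]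
    rw [Finset.sum_congr rfl hval, Finset.sum_const, hc3, nsmul_eq_mul]
    norm_num
  -- the `4`-subsets: `2·3(t1z1 − lost4) + 2·3(t1z1 − lost4) + 4·t1z1`
  have h4 : ∑ B ∈ G.powersetCard 4, ∑ X ∈ witnessFamily K n, f B X =
      2 * (3 * W1.t1z1Sum n - 3 * W1.t1lost4Sum n) + 2 * (3 * W1.t1z1Sum n - 3 * W1.t1lost4Sum n) +
        4 * W1.t1z1Sum n := by
    apply sum_powersetCard_four_twoLines hG h'
    · intro B hB hl
      have hBc := (Finset.mem_powersetCard.1 hB).2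
      have hl' : ¬ ℓ' ⊆ B := fun hl' => hnotboth B hB ⟨hl, hl'⟩
      have hval : ∀ X ∈ witnessFamily K n, f B X =
          if ¬ C ⊆ X then 3 / (((4 + X.card).choose 3 : ℕ) : ℚ) else 0 := by
        intro X _
        rw [hf]
        dsimp only
        by_cases hCX : C ⊆ X
        · rw [if_neg (fun hgd => hgd.1 hl hCX), if_neg (by tauto)]
        · rw [if_pos ⟨fun _ => hCX, fun h => absurd h hl'⟩, if_pos hCX, hBc,
            show Nat.choose 4 3 = 4 by norm_num [Nat.choose]]
          simp only [if_pos hl, if_neg hl', Nat.sub_zero]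
          norm_num
      rw [Finset.sum_congr rfl hval, ← Finset.sum_filter, sum_good_four_t1 (by omega) hKcard hCK hCc]
    · intro B hB hl'
      have hBc := (Finset.mem_powersetCard.1 hB).2
      have hl : ¬ ℓ ⊆ B := fun hl => hnotboth B hB ⟨hl, hl'⟩
      have hval : ∀ X ∈ witnessFamily K n, f B X =
          if ¬ C' ⊆ X then 3 / (((4 + X.card).choose 3 : ℕ) : ℚ) else 0 := by
        intro X _
        rw [hf]
        dsimp only
        by_cases hCX : C' ⊆ X
        · rw [if_neg (fun hgd => hgd.2 hl' hCX), if_neg (by tauto)]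
        · rw [if_pos ⟨fun h => absurd h hl, fun _ => hCX⟩, if_pos hCX, hBc,
            show Nat.choose 4 3 = 4 by norm_num [Nat.choose]]
          simp only [if_neg hl, if_pos hl', Nat.sub_zero]
          norm_num
      rw [Finset.sum_congr rfl hval, ← Finset.sum_filter, sum_good_four_t1 (by omega) hKcard hC'K hC'c]
    · intro B hB hl hl'
      have hBc := (Finset.mem_powersetCard.1 hB).2
      have hval : ∀ X ∈ witnessFamily K n, f B X = 4 / (((4 + X.card).choose 3 : ℕ) : ℚ) := by
        intro X _
        rw [hf]
        dsimp only
        rw [if_pos ⟨fun h => absurd h hl, fun h => absurd h hl'⟩, hBc,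
          show Nat.choose 4 3 = 4 by norm_num [Nat.choose]]
        simp only [if_neg hl, if_neg hl', Nat.sub_zero]
        norm_num
      rw [Finset.sum_congr rfl hval, sum_witnessFamily K n (fun x => 4 / (((4 + x).choose 3 : ℕ) : ℚ)), hKcard]
      unfold W1.t1z1Sum
      rw [Finset.mul_sum]
      apply Finset.sum_congr rfl
      intro i _
      rw [show 4 + (i + 1) = i + 5 by omega]
      ring
  -- the plane: at least `8(t1z2 − 2·lost5)`
  have h5 : 8 * W1.t1z2Sum n - 16 * W1.t1lost5Sum n ≤ ∑ X ∈ witnessFamily K n, f G X := by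
    have hval : ∀ X ∈ witnessFamily K n, f G X =
        if ¬ C ⊆ X ∧ ¬ C' ⊆ X then 8 / (((5 + X.card).choose 3 : ℕ) : ℚ) else 0 := by
      intro X _
      rw [hf]
      dsimp only
      by_cases hgd : ¬ C ⊆ X ∧ ¬ C' ⊆ X
      · rw [if_pos ⟨fun _ => hgd.1, fun _ => hgd.2⟩, if_pos hgd, hGc,
          show Nat.choose 5 3 = 10 by norm_num [Nat.choose]]
        simp only [if_pos hℓG, if_pos hℓ'G]
        norm_num
      · rw [if_neg (fun h => hgd ⟨h.1 hℓG, h.2 hℓ'G⟩), if_neg hgd]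
    rw [Finset.sum_congr rfl hval, ← Finset.sum_filter]
    exact sum_good_both_t1_ge (by omega) hKcard hCK hCc hC'K hC'c
  -- the certificate
  have hphi : phiK (n + 4) 3 = ∑ i ∈ range n, ((n + 4).choose (i + 1) : ℚ) / ((i + 4).choose 3 : ℚ) := by
    unfold phiK
    rw [phiW_eq_phiK_form n]
    rfl
  have hcert := W1.t1_two3B n hn
  rw [← hphi] at hcert
  have htotal : 8 * phiK (n + 4) 3 ≤ ∑ B ∈ ((G.powersetCard 3).erase ℓ).erase ℓ' ∪ G.powersetCard 4 ∪ {G},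
      ∑ X ∈ witnessFamily K n, f B X := by
    rw [Finset.sum_union hd5, Finset.sum_union hd34, Finset.sum_singleton, h3, h4]
    linarith
  calc phiK (n + 4) 3 * ((UqG M (n + 4) 3 G).card : ℚ)
      ≤ phiK (n + 4) 3 * 8 := mul_le_mul_of_nonneg_left hdem (phiK_nonneg _ _)
    _ = 8 * phiK (n + 4) 3 := by ring
    _ ≤ _ := htotal
    _ ≤ ∑ S ∈ Yq M (n + 4) 3, wPlus M G S := hsup

/-- **`R₃⁺` at `t = 1` on the plane «two `3`-point lines through a point»**, every `p = n + 4 ≥ 8`, every finite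
matroid with `ρ(E ∖ G) = p − 1`: either a line lies in `cl(E ∖ G)` (case (B), for that line) or neither does (case (A)). -/
theorem perFlat_twoLines_t1 {G ℓ ℓ' : Finset α} {n : ℕ} (hG : G ∈ flatsQ M 3) (h : TwoLines M G ℓ ℓ')
    (hn : 4 ≤ n) (hK : M.eRk ((gr M \ G : Finset α) : Set α) = ((n + 3 : ℕ) : ℕ∞)) :
    phiK (n + 4) 3 * ((UqG M (n + 4) 3 G).card : ℚ) ≤ ∑ S ∈ Yq M (n + 4) 3, wPlus M G S := by
  by_cases hℓ : (ℓ : Set α) ⊆ M.closure ((gr M \ G : Finset α) : Set α)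
  · exact perFlat_twoLines_t1_of_subset hG h hn hK hℓ
  · by_cases hℓ' : (ℓ' : Set α) ⊆ M.closure ((gr M \ G : Finset α) : Set α)
    · exact perFlat_twoLines_t1_of_subset hG (twoLines_symm h) hn hK hℓ'
    · exact perFlat_twoLines_t1_of_not_subset hG h hn hK hℓ hℓ'

end NightThree

end PercRepro
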